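import Literature.MathematicalPhysics.QuantumFieldTheory.Balaban1983to89.T3PrintedRegularMinimiser
import HarnessLib

/-!
# `Balaban1983to89.T3PrintedRegularMinimiserReduction` — rung R3, crux K1: layer 3 of minimiser stability AT THE MINIMUM OVER PRINT'S
# TWO-CLAUSE REGULAR SPACE — `MinimiserStabilityRegPrAt ⇐ [Balaban1985Variational] Thm 1 (existence of the minimum over (6)) ∧ one-step
# bounds along the printed minimisers` —, and THE BRIDGE to the tree's plaquette-only twins through the located gap G-K1aR-1 as a schema

Cell `ym3-torus` (HUMAN RULING D-0037, YM ladder rung R3), seat `ym3-torus-p1` gen 5; the mirror of `T3RegularMinimiserReduction` (p412092)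
for the printed regular fibre `regFibrePr` of `T3PrintedRegularMinimiser` (cell record HOME/UV3-NODE.md §12, finding F-g5-1).  WHAT THIS IS
NOT: no estimate; every schema is a HYPOTHESIS (never asserted).

* §4 `bgStabilityAt_of_eventually` — finitely many approximations are free for ANY pair of background functionals with a-priori bounds (the
  common core of p411985's / p412092's «eventually» lemmas, stated once for `T3RegularMinimiser.BgStabilityAt`); `HasRegMinimisersPrAt` —
  [Balaban1985Variational] Thm 1 p. 279 with p. 281 l. 19–21 («there exists exactly one critical configuration, which is a minimum of the
  functional (5)» in the space (6) = both clauses of (2) ∩ the constraint) read in the d = 3 family's vocabulary (PORT caveat: print's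
  averaging is [Balaban1985Averaging]'s, the family's is (0.4) of [Balaban1987RG1]); `Upper/LowerAlongRegPrMinimisersAt`; the reduction
  `minimiserStabilityRegPrAt_of_alongRegPrMinimisers`.
* §5 `RegInfAgreeAt` — cell gap G-K1aR-1 («inf over the plaquette-only regular fibre = min over print's two-clause space», NOT PRINTED) as a
  schema — and the bridges `hasRegMinimisersAt_of_printed : HasRegMinimisersPrAt → RegInfAgreeAt → HasRegMinimisersAt`,
  `minimiserStabilityRegAt_of_regPr` / `minimiserStabilityRegPrAt_of_reg`: the plaquette-only child of the pending resplit is [7]'s object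
  plus exactly this one statement.

References: T. Bałaban, CMP 102 (1985) 277–309 [Balaban1985Variational] (Thm 1 (8)–(10) p.279, p.281 l.19–21, (2)/(6) p.278); CMP 99 (1985)
75–102 [Balaban1985RegularSpaces] ((1.9) p.77, (1.34) p.82); CMP 98 (1985) 17–51 [Balaban1985Averaging] (Prop 2 (54)); CMP 102 (1985) 255–275
[Balaban1985UV3] ((41) p.266); C. King, CMP 102 (1986) 649–677 [King1986] (App. (A.5), Thm 3.4); P. Federbush, CMP 110 (1987) 293
[Federbush1987PhaseCellIII] (Thm 4.3).
-/

noncomputable section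

open MeasureTheory Filter Topology
open Literature.MathematicalPhysics.QuantumFieldTheory.Balaban1983to89.T3ContinuumYM3Torus
open Literature.MathematicalPhysics.QuantumFieldTheory.Balaban1983to89.T3UnitLawDensityEML (ℰp measurableE_ℰp)
open Literature.MathematicalPhysics.QuantumFieldTheory.Balaban1983to89.T3UnitScaleTilt
open Literature.MathematicalPhysics.QuantumFieldTheory.Balaban1983to89.T3TiltDescent
open Literature.MathematicalPhysics.QuantumFieldTheory.Balaban1983to89.T3CruxEstimates
open Literature.MathematicalPhysics.QuantumFieldTheory.Balaban1983to89.T3ConstrainedMinimiser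
open Literature.MathematicalPhysics.QuantumFieldTheory.Balaban1983to89.T3DescentFibreTower
open Literature.MathematicalPhysics.QuantumFieldTheory.Balaban1983to89.T3MinimiserStabilityReduction
open Literature.MathematicalPhysics.QuantumFieldTheory.Balaban1983to89.T3RegularMinimiser
open Literature.MathematicalPhysics.QuantumFieldTheory.Balaban1983to89.T3RegularMinimiserReduction
open Literature.MathematicalPhysics.QuantumFieldTheory.Balaban1983to89.T3PrintedRegularMinimiser
open Literature.MathematicalPhysics.QuantumFieldTheory.Balaban1983to89.Missing

namespace Literature.MathematicalPhysics.QuantumFieldTheory.Balaban1983to89.T3PrintedRegularMinimiserReduction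

/-! ## §4 Layer 3 at print's regular background: [7] Thm 1 read in the family's vocabulary, the one-step bounds, the reduction -/

section Reduction

variable (F : T3Family) (γ b₀ p₀ : ℝ) (m : ℕ) (ε₀ : ℝ)

/-- **FINITELY MANY APPROXIMATIONS COST NOTHING — for ANY pair of background functionals bounded between `0` and an a-priori `B₀ K`,
`B₁ K`**: the inequality of `BgStabilityAt` for `K ≥ K₀` with summable `r ≥ 0` suffices (below `K₀` the radius is padded by
`B₁ K + B₀ K + |κ_K|`, a finitely supported sequence).  The common core of p411985's / p412092's «eventually» lemmas, stated once for the
functional-agnostic schema of `T3RegularMinimiser` §1. [cite: Balaban1985UV3, (41) p.266] -/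
theorem bgStabilityAt_of_eventually {F : T3Family} {γ b₀ p₀ : ℝ} {m : ℕ}
    {A₀ A₁ : (K : ℕ) → GaugeField (F.P (K / m)) 0 (Matrix.specialUnitaryGroup (Fin 2) ℂ) → ℝ} (B₀ B₁ : ℕ → ℝ)
    (hA₀ : ∀ K V, 0 ≤ A₀ K V ∧ A₀ K V ≤ B₀ K) (hA₁ : ∀ K V, 0 ≤ A₁ K V ∧ A₁ K V ≤ B₁ K) (K₀ : ℕ) (r κ : ℕ → ℝ) (hr : Summable r)
    (hr0 : ∀ K, 0 ≤ r K)
    (h : ∀ K, K₀ ≤ K → ∀ (V : GaugeField (F.P (K / m)) 0 (Matrix.specialUnitaryGroup (Fin 2) ℂ)),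
      PlaqSmall (θBal F.L γ b₀ p₀ (K / m)) V → |A₁ K V - A₀ K V - κ K| ≤ r K) :
    BgStabilityAt F γ b₀ p₀ m A₀ A₁ := by
  set B : ℕ → ℝ := fun K => B₁ K + B₀ K + |κ K| with hB
  have hBbd : ∀ K (V : GaugeField (F.P (K / m)) 0 (Matrix.specialUnitaryGroup (Fin 2) ℂ)), |A₁ K V - A₀ K V - κ K| ≤ B K := by
    intro K V
    obtain ⟨h00, h01⟩ := hA₀ K V
    obtain ⟨h10, h11⟩ := hA₁ K V
    have k1 := neg_abs_le (κ K)
    have k2 := le_abs_self (κ K)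
    exact abs_le.mpr ⟨by linarith, by linarith⟩
  have hB0 : ∀ K, 0 ≤ B K := fun K => (abs_nonneg _).trans (hBbd K 1)
  have hfin : Summable fun K => if K < K₀ then B K else 0 := by
    refine summable_of_ne_finset_zero (s := Finset.range K₀) fun K hK => ?_
    rw [Finset.mem_range] at hK
    exact if_neg hK
  refine ⟨fun K => r K + (if K < K₀ then B K else 0), κ, hr.add hfin, fun K => add_nonneg (hr0 K) ?_, fun K V hV => ?_⟩
  · by_cases hK : K < K₀
    · rw [if_pos hK]; exact hB0 K
    · rw [if_neg hK]
  · show _ ≤ r K + (if K < K₀ then B K else 0)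
    by_cases hK : K < K₀
    · rw [if_pos hK]
      linarith [hBbd K V, hr0 K]
    · rw [if_neg hK, add_zero]
      exact h K (not_lt.mp hK) V hV

/-- **FINITELY MANY APPROXIMATIONS COST NOTHING** at print's regular background: the inequality of `MinimiserStabilityRegPrAt` for `K ≥ K₀`
with summable `r ≥ 0` suffices (`γ ≥ 0`; the a-priori bound `0 ≤ β·minActionRegPr ≤ β·2·#Plaq`). [cite: Balaban1985Variational, Thm 1 (8) p.279] -/
theorem minimiserStabilityRegPrAt_of_eventually {F γ} (hγ : 0 ≤ γ) {b₀ p₀ m ε₀} (K₀ : ℕ) (r κ : ℕ → ℝ) (hr : Summable r)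
    (hr0 : ∀ K, 0 ≤ r K)
    (h : ∀ K, K₀ ≤ K → ∀ (V : GaugeField (F.P (K / m)) 0 (Matrix.specialUnitaryGroup (Fin 2) ℂ)),
      PlaqSmall (θBal F.L γ b₀ p₀ (K / m)) V → |bgRegPr' F γ m ε₀ K V - bgRegPr F γ m ε₀ K V - κ K| ≤ r K) :
    MinimiserStabilityRegPrAt F γ b₀ p₀ m ε₀ :=
  bgStabilityAt_of_eventually (fun K => (F.scheme ℰp γ).β K * (2 * Fintype.card (Plaq (F.P K) 0)))
    (fun K => (F.scheme ℰp γ).β (K + 1) * (2 * Fintype.card (Plaq (F.P (K + 1)) 0)))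
    (fun K V => ⟨mul_nonneg (F.scheme_β_nonneg ℰp hγ K) (minActionRegPr_nonneg F V),
      mul_le_mul_of_nonneg_left (minActionRegPr_le_two_mul_card F V) (F.scheme_β_nonneg ℰp hγ K)⟩)
    (fun K V => ⟨mul_nonneg (F.scheme_β_nonneg ℰp hγ (K + 1)) (minActionRegPr_nonneg F V),
      mul_le_mul_of_nonneg_left (minActionRegPr_le_two_mul_card F V) (F.scheme_β_nonneg ℰp hγ (K + 1))⟩)
    K₀ r κ hr hr0 h

/-- **EXISTENCE OF THE MINIMUM OVER PRINT'S SPACE (6)** (hypothesis schema, never asserted) — [Balaban1985Variational] Thm 1 read in the d = 3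
family's vocabulary: from some `K₀` on, for every datum `V` on the comparison lattice with plaquettes within `θBal(⌊K/m⌋)` of `1` (hypothesis
(7) with `ε₁ = θBal → 0`, so `B₃ε₁ ≤ ε₀` eventually), the Wilson action attains its minimum on `regFibrePr` (BOTH clauses of (2), threshold
`ε₀`) of run `K` and of run `K+1`.  PRINTED for `B₃ε₁ ≤ ε₀ ≤ a₀(d, L)`: Thm 1 p. 279 with p. 281 l. 19–21 «there exists exactly one critical
configuration, which is a minimum of the functional (5)» in the space (6); PORT caveat: print's constraint (3) is for the averaging of
[Balaban1985Averaging], the family's fibre is for (0.4) of [Balaban1987RG1] (universality asserted there, p. 253–254).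
[cite: Balaban1985Variational, Thm 1 (8) p.279] -/
def HasRegMinimisersPrAt : Prop :=
  ∃ K₀ : ℕ, ∀ K, K₀ ≤ K → ∀ (V : GaugeField (F.P (K / m)) 0 (Matrix.specialUnitaryGroup (Fin 2) ℂ)),
    PlaqSmall (θBal F.L γ b₀ p₀ (K / m)) V →
      (∃ U ∈ regFibrePr F (K / m) K (Nat.div_le_self K m) ε₀ V,
          wilsonAction4 U = minActionRegPr F (K / m) K (Nat.div_le_self K m) ε₀ V) ∧
        ∃ U' ∈ regFibrePr F (K / m) (K + 1) ((Nat.div_le_self K m).trans (Nat.le_succ K)) ε₀ V,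
          wilsonAction4 U' = minActionRegPr F (K / m) (K + 1) ((Nat.div_le_self K m).trans (Nat.le_succ K)) ε₀ V

/-- **ONE-STEP UPPER BOUND ALONG PRINT'S RUN-`K` MINIMISERS** (hypothesis schema, never asserted; INTERP along `U_k`): summable `r_K ≥ 0` and
`K₀` such that every minimiser `U` over print's regular fibre of run `K` admits a PRINTED-REGULAR configuration `U'` of run `K+1` in the fibre
of `V` with `β_{K+1}A(U') ≤ β_K A(U) + r_K` (the regularity (9)–(10) of `U_k` — `|∇^ηA|`, `|Δ^ηA|` — is what makes a one-step interpolation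
land in BOTH clauses at the next cut-off). [cite: Balaban1985Variational, Thm 1 (8)-(10) p.279] -/
def UpperAlongRegPrMinimisersAt : Prop :=
  ∃ (K₀ : ℕ) (r : ℕ → ℝ), Summable r ∧ (∀ K, 0 ≤ r K) ∧
    ∀ K, K₀ ≤ K → ∀ (V : GaugeField (F.P (K / m)) 0 (Matrix.specialUnitaryGroup (Fin 2) ℂ)),
      PlaqSmall (θBal F.L γ b₀ p₀ (K / m)) V →
        ∀ U ∈ regFibrePr F (K / m) K (Nat.div_le_self K m) ε₀ V,
          wilsonAction4 U = minActionRegPr F (K / m) K (Nat.div_le_self K m) ε₀ V →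
            ∃ U' ∈ regFibrePr F (K / m) (K + 1) ((Nat.div_le_self K m).trans (Nat.le_succ K)) ε₀ V,
              (F.scheme ℰp γ).β (K + 1) * wilsonAction4 U' ≤ (F.scheme ℰp γ).β K * wilsonAction4 U + r K

/-- **ONE-STEP LOWER BOUND ALONG PRINT'S RUN-`(K+1)` MINIMISERS** (hypothesis schema, never asserted; AVG-INEQ along `U'_{k+1}`): summable
`r_K ≥ 0` and `K₀` such that every minimiser `U'` over print's regular fibre of run `K+1` admits a PRINTED-REGULAR configuration `U` of run `K`
in the fibre of `V` with `β_K A(U) ≤ β_{K+1}A(U') + r_K` ([Balaban1985Averaging] Prop 2 (54): averages of regular fields are regular;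
[Federbush1987PhaseCellIII] Thm 4.3 in kind). [cite: Federbush1987PhaseCellIII, Thm 4.3 (4.5) p.299] -/
def LowerAlongRegPrMinimisersAt : Prop :=
  ∃ (K₀ : ℕ) (r : ℕ → ℝ), Summable r ∧ (∀ K, 0 ≤ r K) ∧
    ∀ K, K₀ ≤ K → ∀ (V : GaugeField (F.P (K / m)) 0 (Matrix.specialUnitaryGroup (Fin 2) ℂ)),
      PlaqSmall (θBal F.L γ b₀ p₀ (K / m)) V →
        ∀ U' ∈ regFibrePr F (K / m) (K + 1) ((Nat.div_le_self K m).trans (Nat.le_succ K)) ε₀ V,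
          wilsonAction4 U' = minActionRegPr F (K / m) (K + 1) ((Nat.div_le_self K m).trans (Nat.le_succ K)) ε₀ V →
            ∃ U ∈ regFibrePr F (K / m) K (Nat.div_le_self K m) ε₀ V,
              (F.scheme ℰp γ).β K * wilsonAction4 U ≤ (F.scheme ℰp γ).β (K + 1) * wilsonAction4 U' + r K

variable {F γ b₀ p₀ m ε₀}

/-- **THE REDUCTION AT PRINT'S REGULAR BACKGROUND** (`γ ≥ 0`): the three schemas ⇒ `MinimiserStabilityRegPrAt F γ b₀ p₀ m ε₀` (κ ≡ 0, radii
`r + r'` from the larger `K₀` on). [cite: King1986, App. (A.5) p.676] -/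
theorem minimiserStabilityRegPrAt_of_alongRegPrMinimisers (hγ : 0 ≤ γ) (hex : HasRegMinimisersPrAt F γ b₀ p₀ m ε₀)
    (hup : UpperAlongRegPrMinimisersAt F γ b₀ p₀ m ε₀) (hlow : LowerAlongRegPrMinimisersAt F γ b₀ p₀ m ε₀) :
    MinimiserStabilityRegPrAt F γ b₀ p₀ m ε₀ := by
  obtain ⟨K₁, hex⟩ := hex
  obtain ⟨K₂, r, hr, hr0, hup⟩ := hup
  obtain ⟨K₃, r', hr', hr0', hlow⟩ := hlow
  refine minimiserStabilityRegPrAt_of_eventually hγ (max K₁ (max K₂ K₃)) (fun K => r K + r' K) (fun _ => 0)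
    (hr.add hr') (fun K => add_nonneg (hr0 K) (hr0' K)) fun K hK V hV => ?_
  have hK₁ : K₁ ≤ K := (le_max_left _ _).trans hK
  have hK₂ : K₂ ≤ K := ((le_max_left _ _).trans (le_max_right _ _)).trans hK
  have hK₃ : K₃ ≤ K := ((le_max_right _ _).trans (le_max_right _ _)).trans hK
  obtain ⟨⟨U, hU, hUmin⟩, ⟨U', hU', hU'min⟩⟩ := hex K hK₁ V hV
  obtain ⟨W', hW', hupW⟩ := hup K hK₂ V hV U hU hUmin
  obtain ⟨W, hW, hlowW⟩ := hlow K hK₃ V hV U' hU' hU'min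
  have hβ := F.scheme_β_nonneg ℰp hγ K
  have hβ' := F.scheme_β_nonneg ℰp hγ (K + 1)
  have h1 : bgRegPr' F γ m ε₀ K V ≤ bgRegPr F γ m ε₀ K V + r K := by
    show (F.scheme ℰp γ).β (K + 1) * _ ≤ (F.scheme ℰp γ).β K * _ + r K
    rw [← hUmin]
    exact (mul_le_mul_of_nonneg_left (minActionRegPr_le F hW') hβ').trans hupW
  have h2 : bgRegPr F γ m ε₀ K V ≤ bgRegPr' F γ m ε₀ K V + r' K := by
    show (F.scheme ℰp γ).β K * _ ≤ (F.scheme ℰp γ).β (K + 1) * _ + r' K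
    rw [← hU'min]
    exact (mul_le_mul_of_nonneg_left (minActionRegPr_le F hW) hβ).trans hlowW
  have := hr0 K
  have := hr0' K
  rw [sub_zero]
  exact abs_le.mpr ⟨by linarith, by linarith⟩

/-- All the way to K1's body at print's regular background: the three schemas ∧ `FluctuationComparisonRegPrAt` ⇒ `UnitTiltAt F γ b₀ p₀ m`.
[cite: King1986, Thm 3.4 (3.9) p.656] -/
theorem unitTiltAt_of_alongRegPrMinimisers_fluctuationRegPr (hγ : 0 ≤ γ) (hex : HasRegMinimisersPrAt F γ b₀ p₀ m ε₀)
    (hup : UpperAlongRegPrMinimisersAt F γ b₀ p₀ m ε₀) (hlow : LowerAlongRegPrMinimisersAt F γ b₀ p₀ m ε₀)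
    (hfl : FluctuationComparisonRegPrAt F γ b₀ p₀ m ε₀) : UnitTiltAt F γ b₀ p₀ m :=
  (heightSandwich_unitTilt_of_regPr hγ (minimiserStabilityRegPrAt_of_alongRegPrMinimisers hγ hex hup hlow) hfl).2

end Reduction

/-! ## §5 The located gap between the plaquette-only twins and print, as a schema, and the bridge -/

section Bridge

variable (F : T3Family) (γ b₀ p₀ : ℝ) (m : ℕ) (ε₀ : ℝ)

/-- **CELL GAP G-K1aR-1 AS A SCHEMA** (hypothesis, never asserted; NOT PRINTED): from some `K₀` on, for every small datum `V`, the minimum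
of the Wilson action over the tree's plaquette-only regular fibre EQUALS the minimum over print's two-clause space (6), for run `K` and
run `K+1` — what separates `T3RegularMinimiserReduction.HasRegMinimisersAt` from [Balaban1985Variational] Thm 1 (whose uniqueness and gauge
fixing, [Balaban1985RegularSpaces] (1.34) p. 82, are stated on the two-clause space only). [cite: Balaban1985Variational, Thm 1 p.279] -/
def RegInfAgreeAt : Prop :=
  ∃ K₀ : ℕ, ∀ K, K₀ ≤ K → ∀ (V : GaugeField (F.P (K / m)) 0 (Matrix.specialUnitaryGroup (Fin 2) ℂ)),
    PlaqSmall (θBal F.L γ b₀ p₀ (K / m)) V →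
      minActionReg F ℰp (K / m) K (Nat.div_le_self K m) ε₀ V = minActionRegPr F (K / m) K (Nat.div_le_self K m) ε₀ V ∧
        minActionReg F ℰp (K / m) (K + 1) ((Nat.div_le_self K m).trans (Nat.le_succ K)) ε₀ V =
          minActionRegPr F (K / m) (K + 1) ((Nat.div_le_self K m).trans (Nat.le_succ K)) ε₀ V

variable {F γ b₀ p₀ m ε₀}

/-- **THE BRIDGE, EXISTENCE**: [7] Thm 1 (minimum over print's space) ∧ G-K1aR-1 ⇒ the tree's `HasRegMinimisersAt` (the printed minimiser lies
in the plaquette-only regular fibre and realises its infimum). [cite: Balaban1985Variational, Thm 1 (8) p.279] -/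
theorem hasRegMinimisersAt_of_printed (hex : HasRegMinimisersPrAt F γ b₀ p₀ m ε₀) (hagree : RegInfAgreeAt F γ b₀ p₀ m ε₀) :
    HasRegMinimisersAt F γ b₀ p₀ m ε₀ := by
  obtain ⟨K₁, hex⟩ := hex
  obtain ⟨K₂, hagree⟩ := hagree
  refine ⟨max K₁ K₂, fun K hK V hV => ?_⟩
  obtain ⟨⟨U, hU, hUmin⟩, ⟨U', hU', hU'min⟩⟩ := hex K ((le_max_left _ _).trans hK) V hV
  obtain ⟨ha, ha'⟩ := hagree K ((le_max_right _ _).trans hK) V hV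
  exact ⟨⟨U, regFibrePr_subset_regFibre F V hU, by rw [hUmin, ha]⟩, ⟨U', regFibrePr_subset_regFibre F V hU', by rw [hU'min, ha']⟩⟩

/-- **THE BRIDGE, BACKGROUND STABILITY**: under G-K1aR-1 the two backgrounds agree from `K₀` on, so minimiser stability at print's regular
background gives it at the plaquette-only one (`γ ≥ 0`; finitely many `K` are free). [cite: Balaban1985Variational, Thm 1 (8) p.279] -/
theorem minimiserStabilityRegAt_of_regPr (hγ : 0 ≤ γ) (hst : MinimiserStabilityRegPrAt F γ b₀ p₀ m ε₀)
    (hagree : RegInfAgreeAt F γ b₀ p₀ m ε₀) : MinimiserStabilityRegAt F γ b₀ p₀ m ε₀ := by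
  obtain ⟨r, κ, hr, hr0, hst⟩ := hst
  obtain ⟨K₀, hagree⟩ := hagree
  refine minimiserStabilityRegAt_of_eventually hγ K₀ r κ hr hr0 fun K hK V hV => ?_
  obtain ⟨ha, ha'⟩ := hagree K hK V hV
  have h := hst K V hV
  simp only [bgRegPr, bgRegPr'] at h
  simp only [bgReg, bgReg', ha, ha']
  exact h

/-- … and conversely: at the plaquette-only background ∧ G-K1aR-1 ⇒ at print's. [cite: Balaban1985Variational, Thm 1 (8) p.279] -/
theorem minimiserStabilityRegPrAt_of_reg (hγ : 0 ≤ γ) (hst : MinimiserStabilityRegAt F γ b₀ p₀ m ε₀)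
    (hagree : RegInfAgreeAt F γ b₀ p₀ m ε₀) : MinimiserStabilityRegPrAt F γ b₀ p₀ m ε₀ := by
  obtain ⟨r, κ, hr, hr0, hst⟩ := hst
  obtain ⟨K₀, hagree⟩ := hagree
  refine minimiserStabilityRegPrAt_of_eventually hγ K₀ r κ hr hr0 fun K hK V hV => ?_
  obtain ⟨ha, ha'⟩ := hagree K hK V hV
  have h := hst K V hV
  simp only [bgReg, bgReg'] at h
  simp only [bgRegPr, bgRegPr', ← ha, ← ha']
  exact h

end Bridge

end Literature.MathematicalPhysics.QuantumFieldTheory.Balaban1983to89.T3PrintedRegularMinimiserReduction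

end
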